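import Literature.Topology.PlanarFoliations.ChainCase
import Literature.Topology.PlanarFoliations.CentreCase
import HarnessLib

/-!
# The minimiser scheme: a terminal essential pattern exists, given hugging

Topic: Topology / PlanarFoliations, sequel to `PatternMinimiser.lean`, `ChainCofinal.lean`,
`ChainLimit.lean`, `ChainCase.lean`, `CentreCase.lean`. The bookkeeping of the minimiser scheme of
the graph case of the vanishing-cycle theorem. Fix star data `D`, an essential compact leaf
`K₀ = F.leaf x₀` with disc in the region. An essential pattern (compact leaf or simple separatrix
polygon in the disc, `CompactPattern` / `PolyPattern`) is **terminal** when no essential pattern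
has its fill strictly inside its fill. **Theorem** (`exists_terminal_pattern`): *granted the
hugging principle* — for every strictly decreasing sequence of essential compact leaves in the
disc whose limit set has a domain point on its frontier but no compact frontier leaf, some
essential polygon has its fill in the limit set (the one remaining geometric step, taken here as an
explicit hypothesis) — **there is a terminal essential pattern**: a polygon of minimal count is
terminal (`PatternMinimiser`); otherwise the compact patterns of minimal count inside one of them
form a chain (`CompactPattern.nested_of_minimisers`); a least disc of the chain is terminal; and a
chain without least disc has a strictly decreasing cofinal sequence (`exists_seq_strictAnti_cofinal`)
whose limit set has a domain frontier point (`CentreCase`), whose leaf is neither compact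
(`ChainCase`) nor — by hugging and minimality — open.

## References

* C. Camacho, A. Lins Neto, *Geometric Theory of Foliations*, Birkhäuser (1985), Ch. VII §2
  [CamachoLinsNeto1985].
-/

noncomputable section

open Set Filter Function
open _root_.Topology
open Literature.Topology.FourManifolds Literature.Topology.FourManifolds.Foliation Literature.Topology.PlaneTopology

namespace Literature.Topology.PlanarFoliations

variable {X : Type*} [TopologicalSpace X] [T2Space X] [SecondCountableTopology X] [Nonempty X] {F : Foliation ℝ X} {ι : X → ℂ}
variable {B : Type*} [NormedAddCommGroup B] [NormedSpace ℝ B] [LocallyConnectedSpace B] {M : Type*} [TopologicalSpace M]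
  {T : Foliation B M} {g : ℂ → M}

namespace StarData

variable (D : StarData F ι T g) (hbi : IsBiOriented F) (hι : IsOpenEmbedding ι) (ho : F.IsTransverselyOriented)
  {x₀ : X} (hK₀ : IsCompact (F.leaf x₀)) (hC₀ : IsCompact (discLeaf F ι x₀)) (hΩ : discLeaf F ι x₀ ⊆ D.Ω)
  (hess₀ : ¬ ImageNull D.foliated x₀)

include ho hK₀ hΩ hess₀ in
/-- **A terminal essential pattern exists, given the hugging principle.** See the module
docstring. [cite: CamachoLinsNeto1985, Ch. VII §2] -/
theorem exists_terminal_pattern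
    (hHug : ∀ K : ℕ → X, (∀ n, IsCompact (F.leaf (K n))) → (∀ n, discLeaf F ι (K (n + 1)) ⊂ discLeaf F ι (K n)) →
      (∀ n, ¬ ImageNull D.foliated (K n)) → (∀ n, discLeaf F ι (K n) ⊆ discLeaf F ι x₀) →
      (∃ y, ι y ∈ frontier (Dlim ι F K)) → (∀ y, ι y ∈ frontier (Dlim ι F K) → ¬ IsCompact (F.leaf y)) →
      ∃ P : D.PolyPattern hbi hι x₀ hC₀, P.Z.fill hι hC₀ ⊆ Dlim ι F K) :
    (∃ P : D.PolyPattern hbi hι x₀ hC₀,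
      (∀ Q : D.PolyPattern hbi hι x₀ hC₀, Q.Z.fill hι hC₀ ⊆ P.Z.fill hι hC₀ → Q.Z.fill hι hC₀ = P.Z.fill hι hC₀) ∧
      (∀ Q : D.CompactPattern x₀, discLeaf F ι Q.y ⊆ P.Z.fill hι hC₀ → discLeaf F ι Q.y = P.Z.fill hι hC₀)) ∨
    (∃ K : D.CompactPattern x₀,
      (∀ Q : D.PolyPattern hbi hι x₀ hC₀, Q.Z.fill hι hC₀ ⊆ discLeaf F ι K.y → Q.Z.fill hι hC₀ = discLeaf F ι K.y) ∧
      (∀ Q : D.CompactPattern x₀, discLeaf F ι Q.y ⊆ discLeaf F ι K.y → discLeaf F ι Q.y = discLeaf F ι K.y)) := by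
  set n₀ := minCount D hbi hι x₀ hC₀ with hn₀
  by_cases hpoly : ∃ P : D.PolyPattern hbi hι x₀ hC₀, P.val = n₀
  · -- (M2) a polygon of minimal count is terminal
    obtain ⟨P, hP⟩ := hpoly
    exact Or.inl ⟨P, fun Q hQ ↦ P.fill_eq_of_fill_subset Q hP hQ, fun Q hQ ↦ P.discLeaf_eq_of_subset Q hP hQ⟩
  -- (M3) all minimisers are compact
  have hpoly' : ∀ P : D.PolyPattern hbi hι x₀ hC₀, P.val ≠ n₀ := fun P h ↦ hpoly ⟨P, h⟩
  obtain ⟨Z₀, hZ₀⟩ : ∃ Z₀ : D.CompactPattern x₀, Z₀.val = n₀ := by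
    rcases minCount_mem (hbi := hbi) (hι := hι) (hC₀ := hC₀) hK₀ hess₀ with ⟨K, hK⟩ | ⟨P, hP⟩
    · exact ⟨K, hK⟩
    · exact absurd hP (hpoly' P)
  set A := discLeaf F ι Z₀.y with hAdef
  have hA : D.count A = n₀ := hZ₀
  -- the compact minimisers inside `A`
  set 𝓚 : Set (D.CompactPattern x₀) := {Q | Q.val = n₀ ∧ discLeaf F ι Q.y ⊆ A} with h𝓚
  have hZ₀𝓚 : Z₀ ∈ 𝓚 := ⟨hZ₀, Subset.rfl⟩
  by_cases hmin : ∃ Q ∈ 𝓚, ∀ Q' ∈ 𝓚, discLeaf F ι Q'.y ⊆ discLeaf F ι Q.y → discLeaf F ι Q'.y = discLeaf F ι Q.y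
  · -- a least disc of the chain is terminal
    obtain ⟨Q, hQ, hleast⟩ := hmin
    have hcountQ : D.count (discLeaf F ι Q.y) = n₀ := hQ.1
    refine Or.inr ⟨Q, fun P hP ↦ absurd (P.val_eq_of_sub hcountQ hP) (hpoly' P), fun Q' hQ' ↦ ?_⟩
    exact hleast Q' ⟨Q'.val_eq_of_sub hcountQ hQ', hQ'.trans hQ.2⟩ hQ'
  -- no least disc: a strictly decreasing cofinal sequence
  exfalso
  have hnomin : ∀ Q ∈ 𝓚, ∃ Q' ∈ 𝓚, discLeaf F ι Q'.y ⊂ discLeaf F ι Q.y := by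
    intro Q hQ
    by_contra h
    refine hmin ⟨Q, hQ, fun Q' hQ' hsub ↦ ?_⟩
    by_contra hne
    exact h ⟨Q', hQ', hsub, fun hsub' ↦ hne (hsub.antisymm hsub')⟩
  set S : Set (Set ℂ) := (fun Q : D.CompactPattern x₀ ↦ discLeaf F ι Q.y) '' 𝓚 with hS
  have hchain : IsChain (· ⊆ ·) S := by
    rintro _ ⟨Q, hQ, rfl⟩ _ ⟨Q', hQ', rfl⟩ _
    exact CompactPattern.nested_of_minimisers hΩ hA Q Q' hQ.2 hQ'.2
  obtain ⟨Aseq, hAS, hAdec, hAcof⟩ := exists_seq_strictAnti_cofinal hchain ⟨_, Z₀, hZ₀𝓚, rfl⟩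
    (by rintro _ ⟨Q, -, rfl⟩; exact isClosed_discLeaf hbi hι Q.compact)
    (by rintro _ ⟨Q, hQ, rfl⟩; obtain ⟨Q', hQ', hlt⟩ := hnomin Q hQ; exact ⟨_, ⟨Q', hQ', rfl⟩, hlt⟩)
  choose Kseq hKseq𝓚 hKseqeq using fun n ↦ hAS n
  -- the sequence of compact leaves
  set K : ℕ → X := fun n ↦ (Kseq n).y with hKdef
  have hK : ∀ n, IsCompact (F.leaf (K n)) := fun n ↦ (Kseq n).compact
  have hKeq : ∀ n, discLeaf F ι (Kseq n).y = Aseq n := fun n ↦ hKseqeq n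
  have hdec : ∀ n, discLeaf F ι (K (n + 1)) ⊂ discLeaf F ι (K n) := fun n ↦ by
    show discLeaf F ι (Kseq (n + 1)).y ⊂ discLeaf F ι (Kseq n).y
    rw [hKeq, hKeq]; exact hAdec n
  have hess : ∀ n, ¬ ImageNull D.foliated (K n) := fun n ↦ (Kseq n).ess
  have hsub₀ : ∀ n, discLeaf F ι (K n) ⊆ discLeaf F ι x₀ := fun n ↦ (Kseq n).sub
  have hKA : ∀ n, discLeaf F ι (K n) ⊆ A := fun n ↦ (hKseq𝓚 n).2
  have hcof : ∀ Q : D.CompactPattern x₀, Q.val = n₀ → discLeaf F ι Q.y ⊆ A → ∃ n, discLeaf F ι (K n) ⊆ discLeaf F ι Q.y := by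
    intro Q hQv hQA
    obtain ⟨n, hn⟩ := hAcof _ ⟨Q, ⟨hQv, hQA⟩, rfl⟩
    exact ⟨n, by show discLeaf F ι (Kseq n).y ⊆ _; rw [hKeq]; exact hn⟩
  have hnomin' : ∀ Q : D.CompactPattern x₀, Q.val = n₀ → discLeaf F ι Q.y ⊆ A →
      ∃ Q' : D.CompactPattern x₀, Q'.val = n₀ ∧ discLeaf F ι Q'.y ⊆ A ∧ discLeaf F ι Q'.y ⊂ discLeaf F ι Q.y := by
    intro Q hQv hQA
    obtain ⟨Q', hQ', hlt⟩ := hnomin Q ⟨hQv, hQA⟩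
    exact ⟨Q', hQ'.1, hQ'.2, hlt⟩
  -- a domain point on the frontier of the limit set (the centre case is excluded)
  have hfr : ∃ y, ι y ∈ frontier (Dlim ι F K) := by
    by_contra h
    push Not at h
    exact D.toPunctureData.false_of_forall_not_mem_frontier hbi hι hK hdec hess ((hsub₀ 0).trans hΩ) h
  -- its leaf is not compact (chain case) ...
  have hnc : ∀ y, ι y ∈ frontier (Dlim ι F K) → ¬ IsCompact (F.leaf y) := fun y hy hcy ↦
    false_of_compact_frontier_leaf_of_cofinal (hbi := hbi) (hι := hι) (hC₀ := hC₀) ho hK hdec hess hsub₀ hA hKA hcof hnomin' hy hcy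
  -- ... so hugging gives an essential polygon in the limit set, of minimal count: a polygon minimiser
  obtain ⟨P, hP⟩ := hHug K hK hdec hess hsub₀ hfr hnc
  have hPA : P.Z.fill hι hC₀ ⊆ A := hP.trans ((iInter_subset _ 0).trans (hKA 0))
  exact hpoly' P (P.val_eq_of_sub hA hPA)

end StarData

end Literature.Topology.PlanarFoliations
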